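import Summits.QuantumFields.BalabanUV.Beta.D1BFx.SliceTransferDefectJets

/-!
# `BalabanUV.Beta.D1BFx.SliceTransferDefectHess` — road «BF-x» for binder row D1, slot (K), row **(K8-L) «NON-LOCAL REDUCTION»**, PART 2b:
# THE SECOND VARIATION OF THE SLICE TRANSFER WITH DEFECT — `Hess F_M(at the deflated jets) + Hess ½log det Φ = Hess ½log det_{ker Q}(K+B)
# + comb Gram`, in K-TA4G's `hessT` jet currency, with NO Ward letter on the form and NO rank hypothesis on the weight

HONEST DEPENDENCY (cell records, verbatim): «continuum YM on T⁴ ⇐ BetaPertH ∧ nine spine estimates (0/9 proved); BetaPertH ⇐ (D1) ∧ (D4) ∧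
CAP+tail; G-an2-4 gates asym, D1 and NE2/3/4.»  HONEST FRAMING (cell contract, verbatim): «discharging `BetaPertH` makes Bałaban's UV stability
UNCONDITIONAL — a real constructive-QFT result; it is NOT the continuum limit and NOT the Clay problem.»  THIS MODULE DISCHARGES NOTHING of (K),
of D1 or of the wall: [folklore] one instantiation of gan24-leaf-03's K-TA4G `GramWeightJetsMixed.hessT_gramTransfer_jets` BY NAME at the
deflated jets of PART 2a (`SliceTransferDefectJets`), whose Ward letters are theorems there, plus the Gram-split bookkeeping
(`hessT_gram_split_jets`) and a fifteen-line inverse-jet identity.  No definition, no `def … : Prop`, nothing cited, no wall binder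
instantiated, 0 sorry.  The structural letter «WARD-L» of F-g8-2 §2 is NOT touched.  NOT D1, NOT BetaPertH, NOT continuum, NOT Clay.

ABSOLUTE RULE (cell charter, verbatim): «No internally-minted statement may enter as a cited fact. Every hypothesis is either kernel-proved in this
package or a verbatim quotation of a PUBLISHED theorem with page reference. The manuscript(s) under audit are NOT citable for their own disputed
steps — they are the thing under adjudication; programme-internal (2001/route/tribunal) claims are never citable.»

THE STATEMENT (`hessT_deflate_transfer_jets`; owner FINDING F-g8-2 §0 item 2 ∕ RULING ρ-g8-3, cut «(ii)»).  2-parameter FORMAL jet data: a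
symmetric form `Y•` (`Y₀ Yₛ Yₜ Yₛₜ`; on the road `Y = K + B`, Hessian plus weight), gauge modes `W•`, constraints `Q•` with the kinematic letters
`Q₀W₀ = 0`, `QₛW₀ + Q₀Wₛ = 0`, `QₜW₀ + Q₀Wₜ = 0`, `QₛₜW₀ + QₛWₜ + QₜWₛ + Q₀Wₛₜ = 0` (the b•-letters of K-TA4G — the ONLY letters assumed),
constant comb rows `τ`; nondegeneracy of `Φ₀ = W₀ᵀY₀W₀`, of `τW₀` and of the sharp system `kkt (deflJet₀ Y₀ W₀) [Q₀; τ]` at the deflated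
form.  Then, with the FP-Gram jets `Φ• = gram• W Y` and the deflated jets `K̃• = deflJet•` of PART 2a (`= (K + defect K B W)•`),

  hessT (M̃₀⁻¹|_{ν⊕μ}; kkt K̃ₛ Qₛ, kkt K̃ₜ Qₜ, kkt K̃ₛₜ Qₛₜ) + hessT (Φ₀⁻¹; Φₛ, Φₜ, Φₛₜ)
      = hessT ((kkt Y₀ Q₀)⁻¹; kkt Yₛ Qₛ, kkt Yₜ Qₜ, kkt Yₛₜ Qₛₜ) + 2·hessT ((τW₀)⁻¹; τWₛ, τWₜ, τWₛₜ),     M̃₀ := kkt K̃₀ [Q₀; τ].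

READING (F-g8-2): the right-hand side is the WEIGHTED (`R`-gauge) one-loop Hessian + the comb Gram (U-free on the road); the left-hand side is
the SHARP-gauge one-loop Hessian evaluated NOT at the form's own jets `K•` but at the DEFLATED jets `K̃• = (K + D)•` — the difference
`hessT(M̃₀⁻¹; K̃•) − hessT(M₀⁻¹; K•)` is the owner's `X₄`∕`Δ_{R1}`, a functional of the Ward failures `E• = (KW)•` (first jet in closed
form: PART 2c); under «WARD-L» (`E• = 0`) and a rank-`|ρ|` weight `D• = 0` and the statement IS K-TA4G.  Nothing here decides whether
Bałaban's typed literal satisfies WARD-L.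
CONTENT: §1 `hessT_invJets` (`hessT (G₀; inverse jets of G) = −hessT (G₀⁻¹; jets of G)`), `deflJet•_add_gram` (`K̃• + gram•(T,A) = Y•` by
construction); §2 **`hessT_deflate_transfer_jets`**; §3 the road's letters: `hessT_defect_transfer_jets` — the same with `Y• := K• + B•`
displayed and `M̃₀ = kkt (K₀ + defect K₀ B₀ W₀) [Q₀; τ]`.
Provenance: D1 formalisation swarm leaf seat `b2b-balaban-beta-d1-formalise-leaf-04` gen 8 (claim «D1-BFx-K8L» PART 2, cut (ii) by the road
owner `b2b-balaban-beta-d1-p2` gen 8), 2026-08-21.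
-/

noncomputable section

namespace Summit.QuantumFields.BalabanUV.Beta.D1BFx.SliceTransferDefectHess

open Matrix
open Literature.MathematicalPhysics.QuantumFieldTheory.Balaban1983to89.Beta.Composition (kkt)
open Summit.QuantumFields.BalabanUV.Beta.D1BFx.MixedVarPackedHess (hessT)
open Summit.QuantumFields.BalabanUV.Beta.D1BFx.GramWeightJets (gram₀ gram₁)
open Summit.QuantumFields.BalabanUV.Beta.D1BFx.GramWeightJetsMixed (gramMix hessT_gramTransfer_jets hessT_gram_split_jets)
open Summit.QuantumFields.BalabanUV.Beta.D1BFx.SliceTransferDefect (defect)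
open Summit.QuantumFields.BalabanUV.Beta.D1BFx.SliceTransferDefectJets

/-! ## §1 The inverse-jet functional and the reassembly `K̃• + gram•(T, A) = Y•` -/

section InvJets

variable {κ : Type*} [Fintype κ] [DecidableEq κ]

/-- [folklore] **`hessT` OF THE INVERSE JETS**: the one-loop functional with leg `G₀ = (G₀⁻¹)⁻¹` at the jets of `u ↦ G(u)⁻¹` is MINUS the
functional with leg `G₀⁻¹` at the jets of `G` (`log det G⁻¹ = −log det G`, twice differentiated; mixed-jet twin of
`SliceTransferJetsAlgebra.secondVar_inv_jets`). -/
theorem hessT_invJets (G₀ Gₛ Gₜ Gₛₜ : Matrix κ κ ℝ) (hG : G₀.det ≠ 0) :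
    hessT G₀ (invJet₁ G₀ Gₛ) (invJet₁ G₀ Gₜ) (invJetMix G₀ Gₛ Gₜ Gₛₜ) = -hessT G₀⁻¹ Gₛ Gₜ Gₛₜ := by
  have hGS : G₀ * G₀⁻¹ = 1 := mul_nonsing_inv _ (isUnit_iff_ne_zero.2 hG)
  have c : ∀ X : Matrix κ κ ℝ, G₀ * (G₀⁻¹ * X) = X := fun X => by rw [← Matrix.mul_assoc, hGS, Matrix.one_mul]
  have tr1 : (Gₛ * (G₀⁻¹ * (Gₜ * G₀⁻¹))).trace = (G₀⁻¹ * (Gₛ * (G₀⁻¹ * Gₜ))).trace := by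
    rw [Matrix.trace_mul_comm, show G₀⁻¹ * (Gₜ * G₀⁻¹) * Gₛ = (G₀⁻¹ * Gₜ) * (G₀⁻¹ * Gₛ) by simp only [Matrix.mul_assoc],
      Matrix.trace_mul_comm, Matrix.mul_assoc]
  have tr2 : (Gₜ * (G₀⁻¹ * (Gₛ * G₀⁻¹))).trace = (G₀⁻¹ * (Gₛ * (G₀⁻¹ * Gₜ))).trace := by
    rw [Matrix.trace_mul_comm, Matrix.mul_assoc, Matrix.mul_assoc]
  have tr3 : (Gₛₜ * G₀⁻¹).trace = (G₀⁻¹ * Gₛₜ).trace := Matrix.trace_mul_comm _ _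
  unfold hessT invJet₁ invJetMix
  simp only [Matrix.mul_sub, Matrix.mul_add, Matrix.mul_neg, Matrix.neg_mul, neg_neg, Matrix.mul_assoc, c, Matrix.trace_sub,
    Matrix.trace_add, tr1, tr2, tr3]
  ring

end InvJets

section Main

variable {ν μ ρ : Type*} [Fintype ν] [Fintype μ] [Fintype ρ] [DecidableEq ν] [DecidableEq μ] [DecidableEq ρ]

omit [Fintype μ] [DecidableEq ν] [DecidableEq μ] in
/-- [folklore] Reassembly, order 0: `K̃₀ + gram₀ T₀ A₀ = Y₀` (by construction of `deflJet₀`). -/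
theorem deflJet₀_add_gram (Y₀ : Matrix ν ν ℝ) (W₀ : Matrix ν ρ ℝ) :
    deflJet₀ Y₀ W₀ + gram₀ (W₀ᵀ * Y₀) (gram₀ W₀ Y₀)⁻¹ = Y₀ := by
  unfold deflJet₀; abel

omit [Fintype μ] [DecidableEq ν] [DecidableEq μ] in
/-- [folklore] Reassembly, order 1: `K̃ₛ + gram₁ T₀ Tₛ A₀ Aₛ = Yₛ`. -/
theorem deflJet₁_add_gram (Y₀ Yₛ : Matrix ν ν ℝ) (W₀ Wₛ : Matrix ν ρ ℝ) :
    deflJet₁ Y₀ Yₛ W₀ Wₛ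
        + gram₁ (W₀ᵀ * Y₀) (coT₁ W₀ Wₛ Y₀ Yₛ) (gram₀ W₀ Y₀)⁻¹ (invJet₁ (gram₀ W₀ Y₀) (gram₁ W₀ Wₛ Y₀ Yₛ)) = Yₛ := by
  unfold deflJet₁; abel

omit [Fintype μ] [DecidableEq ν] [DecidableEq μ] in
/-- [folklore] Reassembly, mixed order 2: `K̃ₛₜ + gramMix T• A• = Yₛₜ`. -/
theorem deflJetMix_add_gram (Y₀ Yₛ Yₜ Yₛₜ : Matrix ν ν ℝ) (W₀ Wₛ Wₜ Wₛₜ : Matrix ν ρ ℝ) :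
    deflJetMix Y₀ Yₛ Yₜ Yₛₜ W₀ Wₛ Wₜ Wₛₜ
        + gramMix (W₀ᵀ * Y₀) (coT₁ W₀ Wₛ Y₀ Yₛ) (coT₁ W₀ Wₜ Y₀ Yₜ) (coTMix W₀ Wₛ Wₜ Wₛₜ Y₀ Yₛ Yₜ Yₛₜ)
            (gram₀ W₀ Y₀)⁻¹ (invJet₁ (gram₀ W₀ Y₀) (gram₁ W₀ Wₛ Y₀ Yₛ)) (invJet₁ (gram₀ W₀ Y₀) (gram₁ W₀ Wₜ Y₀ Yₜ))
            (invJetMix (gram₀ W₀ Y₀) (gram₁ W₀ Wₛ Y₀ Yₛ) (gram₁ W₀ Wₜ Y₀ Yₜ) (gramMix W₀ Wₛ Wₜ Wₛₜ Y₀ Yₛ Yₜ Yₛₜ))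
      = Yₛₜ := by
  unfold deflJetMix; abel

/-! ## §2 The second variation of the slice transfer with defect -/

/-- [folklore] **THE SECOND VARIATION OF THE SLICE TRANSFER WITH DEFECT** (F-g8-2 §0 item 2 in jet currency; NO Ward letter on `Y`, NO rank
hypothesis).  For symmetric 2-parameter jets `Y•`, gauge-mode jets `W•`, constraint jets `Q•` with the kinematic letters, constant comb rows `τ`,
and `det Φ₀`, `det(τW₀)`, `det kkt K̃₀ [Q₀; τ] ≠ 0`:
`hessT (M̃₀⁻¹|_{ν⊕μ}; kkt K̃• Q•) + hessT (Φ₀⁻¹; Φ•) = hessT ((kkt Y₀ Q₀)⁻¹; kkt Y• Q•) + 2·hessT ((τW₀)⁻¹; τW•)`,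
`K̃• = deflJet•` (PART 2a), `Φ• = gram• W Y`, `M̃₀ = kkt (deflJet₀ Y₀ W₀) [Q₀; τ]`.  Proof: K-TA4G at `K• := K̃•`, co-frame `T• :=` jets of `WᵀY`,
`A• :=` inverse jets of `Φ`; its a•-letters are PART 2a's identities; the pure second jets are immaterial (set to the diagonal data with
`Wₛₛ = 0`, `Qₛₛ := −2•QₛWₛ(τW₀)⁻¹τ`); the Gram slot folds by `hessT_gram_split_jets` + `hessT_invJets` since `(WᵀY)•·W• = Φ•`. -/
theorem hessT_deflate_transfer_jets (Y₀ Yₛ Yₜ Yₛₜ : Matrix ν ν ℝ) (W₀ Wₛ Wₜ Wₛₜ : Matrix ν ρ ℝ) (Q₀ Qₛ Qₜ Qₛₜ : Matrix μ ν ℝ)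
    (τ : Matrix ρ ν ℝ) (hY₀ : Y₀ᵀ = Y₀) (hYₛ : Yₛᵀ = Yₛ) (hYₜ : Yₜᵀ = Yₜ) (hYₛₜ : Yₛₜᵀ = Yₛₜ)
    (b0 : Q₀ * W₀ = 0) (bₛ : Qₛ * W₀ + Q₀ * Wₛ = 0) (bₜ : Qₜ * W₀ + Q₀ * Wₜ = 0)
    (bₛₜ : Qₛₜ * W₀ + Qₛ * Wₜ + Qₜ * Wₛ + Q₀ * Wₛₜ = 0)
    (hΦ : (gram₀ W₀ Y₀).det ≠ 0) (hτ : (τ * W₀).det ≠ 0) (hM : (kkt (deflJet₀ Y₀ W₀) (fromRows Q₀ τ)).det ≠ 0) :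
    hessT ((kkt (deflJet₀ Y₀ W₀) (fromRows Q₀ τ))⁻¹.submatrix (Sum.map id Sum.inl) (Sum.map id Sum.inl))
        (kkt (deflJet₁ Y₀ Yₛ W₀ Wₛ) Qₛ) (kkt (deflJet₁ Y₀ Yₜ W₀ Wₜ) Qₜ) (kkt (deflJetMix Y₀ Yₛ Yₜ Yₛₜ W₀ Wₛ Wₜ Wₛₜ) Qₛₜ)
      + hessT (gram₀ W₀ Y₀)⁻¹ (gram₁ W₀ Wₛ Y₀ Yₛ) (gram₁ W₀ Wₜ Y₀ Yₜ) (gramMix W₀ Wₛ Wₜ Wₛₜ Y₀ Yₛ Yₜ Yₛₜ)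
    = hessT (kkt Y₀ Q₀)⁻¹ (kkt Yₛ Qₛ) (kkt Yₜ Qₜ) (kkt Yₛₜ Qₛₜ) + 2 * hessT (τ * W₀)⁻¹ (τ * Wₛ) (τ * Wₜ) (τ * Wₛₜ) := by
  have hΦu : IsUnit (gram₀ W₀ Y₀).det := isUnit_iff_ne_zero.2 hΦ
  -- abbreviations: FP-Gram jets
  set Φ₀ := gram₀ W₀ Y₀ with hΦ₀
  set Φₛ := gram₁ W₀ Wₛ Y₀ Yₛ with hΦₛ
  set Φₜ := gram₁ W₀ Wₜ Y₀ Yₜ with hΦₜ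
  set Φₛₜ := gramMix W₀ Wₛ Wₜ Wₛₜ Y₀ Yₛ Yₜ Yₛₜ with hΦₛₜ
  -- manufactured pure second constraint jets (immaterial to the conclusion)
  set σ : Matrix ρ ν ℝ := (τ * W₀)⁻¹ * τ with hσ
  have hσW : σ * W₀ = 1 := by rw [hσ, Matrix.mul_assoc, nonsing_inv_mul _ (isUnit_iff_ne_zero.2 hτ)]
  have bₛₛ : -((2 : ℝ) • (Qₛ * Wₛ * σ)) * W₀ + (2 : ℝ) • (Qₛ * Wₛ) + Q₀ * (0 : Matrix ν ρ ℝ) = 0 := by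
    rw [Matrix.neg_mul, Matrix.smul_mul, Matrix.mul_assoc, hσW, Matrix.mul_one, Matrix.mul_zero, add_zero, neg_add_cancel]
  have bₜₜ : -((2 : ℝ) • (Qₜ * Wₜ * σ)) * W₀ + (2 : ℝ) • (Qₜ * Wₜ) + Q₀ * (0 : Matrix ν ρ ℝ) = 0 := by
    rw [Matrix.neg_mul, Matrix.smul_mul, Matrix.mul_assoc, hσW, Matrix.mul_one, Matrix.mul_zero, add_zero, neg_add_cancel]
  have h0t : (0 : Matrix ν ν ℝ)ᵀ = 0 := Matrix.transpose_zero
  -- nondegeneracy in K-TA4G's slots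
  have hT : (W₀ᵀ * Y₀ * W₀).det ≠ 0 := hΦ
  have hA : (Φ₀⁻¹).det ≠ 0 := (Matrix.isUnit_nonsing_inv_det _ hΦu).ne_zero
  -- K-TA4G at the deflated jets, co-frame `WᵀY`, weight `Φ⁻¹`
  have h := hessT_gramTransfer_jets
    (deflJet₀ Y₀ W₀) (deflJet₁ Y₀ Yₛ W₀ Wₛ) (deflJet₁ Y₀ Yₜ W₀ Wₜ)
    (deflJetMix Y₀ Yₛ Yₛ 0 W₀ Wₛ Wₛ 0) (deflJetMix Y₀ Yₜ Yₜ 0 W₀ Wₜ Wₜ 0) (deflJetMix Y₀ Yₛ Yₜ Yₛₜ W₀ Wₛ Wₜ Wₛₜ)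
    Q₀ Qₛ Qₜ (-((2 : ℝ) • (Qₛ * Wₛ * σ))) (-((2 : ℝ) • (Qₜ * Wₜ * σ))) Qₛₜ
    (W₀ᵀ * Y₀) (coT₁ W₀ Wₛ Y₀ Yₛ) (coT₁ W₀ Wₜ Y₀ Yₜ) (coTMix W₀ Wₛ Wₛ 0 Y₀ Yₛ Yₛ 0) (coTMix W₀ Wₜ Wₜ 0 Y₀ Yₜ Yₜ 0)
    (coTMix W₀ Wₛ Wₜ Wₛₜ Y₀ Yₛ Yₜ Yₛₜ)
    Φ₀⁻¹ (invJet₁ Φ₀ Φₛ) (invJet₁ Φ₀ Φₜ) (invJetMix Φ₀ Φₛ Φₛ (gramMix W₀ Wₛ Wₛ 0 Y₀ Yₛ Yₛ 0))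
    (invJetMix Φ₀ Φₜ Φₜ (gramMix W₀ Wₜ Wₜ 0 Y₀ Yₜ Yₜ 0)) (invJetMix Φ₀ Φₛ Φₜ Φₛₜ)
    W₀ Wₛ Wₜ 0 0 Wₛₜ τ
    (deflJet₀_mul_basis Y₀ W₀ hY₀ hΦu) (deflJet₀_transpose_mul_basis Y₀ W₀ hY₀ hΦu)
    (deflJet₁_mul_basis Y₀ Yₛ W₀ Wₛ hY₀ hYₛ hΦu) (deflJet₁_transpose_mul_basis Y₀ Yₛ W₀ Wₛ hY₀ hYₛ hΦu)
    (deflJet₁_mul_basis Y₀ Yₜ W₀ Wₜ hY₀ hYₜ hΦu) (deflJet₁_transpose_mul_basis Y₀ Yₜ W₀ Wₜ hY₀ hYₜ hΦu)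
    (deflJetMix_mul_basis_diag Y₀ Yₛ W₀ Wₛ 0 0 hY₀ hYₛ h0t hΦu)
    (deflJetMix_transpose_mul_basis_diag Y₀ Yₛ W₀ Wₛ 0 0 hY₀ hYₛ h0t hΦu)
    (deflJetMix_mul_basis_diag Y₀ Yₜ W₀ Wₜ 0 0 hY₀ hYₜ h0t hΦu)
    (deflJetMix_transpose_mul_basis_diag Y₀ Yₜ W₀ Wₜ 0 0 hY₀ hYₜ h0t hΦu)
    (deflJetMix_mul_basis Y₀ Yₛ Yₜ Yₛₜ W₀ Wₛ Wₜ Wₛₜ hY₀ hYₛ hYₜ hYₛₜ hΦu)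
    (deflJetMix_transpose_mul_basis Y₀ Yₛ Yₜ Yₛₜ W₀ Wₛ Wₜ Wₛₜ hY₀ hYₛ hYₜ hYₛₜ hΦu)
    b0 bₛ bₜ bₛₛ bₜₜ bₛₜ hτ hT hA hM
  -- fold the Gram slot: `gram•(W, gram•(T,A))` is `Φ•` in `hessT` currency
  rw [hessT_gram_split_jets (W₀ᵀ * Y₀) (coT₁ W₀ Wₛ Y₀ Yₛ) (coT₁ W₀ Wₜ Y₀ Yₜ) (coTMix W₀ Wₛ Wₛ 0 Y₀ Yₛ Yₛ 0)
    (coTMix W₀ Wₜ Wₜ 0 Y₀ Yₜ Yₜ 0) (coTMix W₀ Wₛ Wₜ Wₛₜ Y₀ Yₛ Yₜ Yₛₜ) Φ₀⁻¹ (invJet₁ Φ₀ Φₛ) (invJet₁ Φ₀ Φₜ)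
    (invJetMix Φ₀ Φₛ Φₛ (gramMix W₀ Wₛ Wₛ 0 Y₀ Yₛ Yₛ 0)) (invJetMix Φ₀ Φₜ Φₜ (gramMix W₀ Wₜ Wₜ 0 Y₀ Yₜ Yₜ 0))
    (invJetMix Φ₀ Φₛ Φₜ Φₛₜ) W₀ Wₛ Wₜ 0 0 Wₛₜ hT hA,
    coT₀_mul, coT₁_mul, coT₁_mul, coTMix_mul, Matrix.nonsing_inv_nonsing_inv _ hΦu, hessT_invJets Φ₀ Φₛ Φₜ Φₛₜ hΦ,
    deflJet₀_add_gram, deflJet₁_add_gram, deflJet₁_add_gram, deflJetMix_add_gram] at h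
  linarith

/-! ## §3 In the road's letters: `Y = K + B`, `M̃₀ = kkt (K₀ + defect K₀ B₀ W₀) [Q₀; τ]` -/

/-- [folklore] **THE SECOND VARIATION OF THE SLICE TRANSFER WITH DEFECT, `Y• := K• + B•` DISPLAYED** (symmetric form jets `K•` and weight
jets `B•`; NO Ward letter `K•W• = 0`, NO co-frame∕rank structure of `B•`): the sharp one-loop functional at the deflated jets of `K + B` — leg
`(kkt (K₀ + defect K₀ B₀ W₀) [Q₀; τ])⁻¹` — plus the FP-Gram functional equals the weighted one-loop functional plus twice the comb Gram one. -/
theorem hessT_defect_transfer_jets (K₀ Kₛ Kₜ Kₛₜ B₀ Bₛ Bₜ Bₛₜ : Matrix ν ν ℝ) (W₀ Wₛ Wₜ Wₛₜ : Matrix ν ρ ℝ)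
    (Q₀ Qₛ Qₜ Qₛₜ : Matrix μ ν ℝ) (τ : Matrix ρ ν ℝ)
    (hK₀ : K₀ᵀ = K₀) (hKₛ : Kₛᵀ = Kₛ) (hKₜ : Kₜᵀ = Kₜ) (hKₛₜ : Kₛₜᵀ = Kₛₜ)
    (hB₀ : B₀ᵀ = B₀) (hBₛ : Bₛᵀ = Bₛ) (hBₜ : Bₜᵀ = Bₜ) (hBₛₜ : Bₛₜᵀ = Bₛₜ)
    (b0 : Q₀ * W₀ = 0) (bₛ : Qₛ * W₀ + Q₀ * Wₛ = 0) (bₜ : Qₜ * W₀ + Q₀ * Wₜ = 0)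
    (bₛₜ : Qₛₜ * W₀ + Qₛ * Wₜ + Qₜ * Wₛ + Q₀ * Wₛₜ = 0)
    (hΦ : (gram₀ W₀ (K₀ + B₀)).det ≠ 0) (hτ : (τ * W₀).det ≠ 0) (hM : (kkt (K₀ + defect K₀ B₀ W₀) (fromRows Q₀ τ)).det ≠ 0) :
    hessT ((kkt (K₀ + defect K₀ B₀ W₀) (fromRows Q₀ τ))⁻¹.submatrix (Sum.map id Sum.inl) (Sum.map id Sum.inl))
        (kkt (deflJet₁ (K₀ + B₀) (Kₛ + Bₛ) W₀ Wₛ) Qₛ) (kkt (deflJet₁ (K₀ + B₀) (Kₜ + Bₜ) W₀ Wₜ) Qₜ)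
        (kkt (deflJetMix (K₀ + B₀) (Kₛ + Bₛ) (Kₜ + Bₜ) (Kₛₜ + Bₛₜ) W₀ Wₛ Wₜ Wₛₜ) Qₛₜ)
      + hessT (gram₀ W₀ (K₀ + B₀))⁻¹ (gram₁ W₀ Wₛ (K₀ + B₀) (Kₛ + Bₛ)) (gram₁ W₀ Wₜ (K₀ + B₀) (Kₜ + Bₜ))
          (gramMix W₀ Wₛ Wₜ Wₛₜ (K₀ + B₀) (Kₛ + Bₛ) (Kₜ + Bₜ) (Kₛₜ + Bₛₜ))
    = hessT (kkt (K₀ + B₀) Q₀)⁻¹ (kkt (Kₛ + Bₛ) Qₛ) (kkt (Kₜ + Bₜ) Qₜ) (kkt (Kₛₜ + Bₛₜ) Qₛₜ)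
      + 2 * hessT (τ * W₀)⁻¹ (τ * Wₛ) (τ * Wₜ) (τ * Wₛₜ) := by
  have hY₀ : (K₀ + B₀)ᵀ = K₀ + B₀ := by rw [Matrix.transpose_add, hK₀, hB₀]
  have hYₛ : (Kₛ + Bₛ)ᵀ = Kₛ + Bₛ := by rw [Matrix.transpose_add, hKₛ, hBₛ]
  have hYₜ : (Kₜ + Bₜ)ᵀ = Kₜ + Bₜ := by rw [Matrix.transpose_add, hKₜ, hBₜ]
  have hYₛₜ : (Kₛₜ + Bₛₜ)ᵀ = Kₛₜ + Bₛₜ := by rw [Matrix.transpose_add, hKₛₜ, hBₛₜ]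
  have hdef : deflJet₀ (K₀ + B₀) W₀ = K₀ + defect K₀ B₀ W₀ := deflJet₀_add_eq W₀ K₀ B₀ hK₀ hB₀
  have hM' : (kkt (deflJet₀ (K₀ + B₀) W₀) (fromRows Q₀ τ)).det ≠ 0 := by rw [hdef]; exact hM
  have h := hessT_deflate_transfer_jets (K₀ + B₀) (Kₛ + Bₛ) (Kₜ + Bₜ) (Kₛₜ + Bₛₜ) W₀ Wₛ Wₜ Wₛₜ Q₀ Qₛ Qₜ Qₛₜ τ hY₀ hYₛ hYₜ hYₛₜ
    b0 bₛ bₜ bₛₜ hΦ hτ hM'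
  rw [hdef] at h
  exact h

end Main

end Summit.QuantumFields.BalabanUV.Beta.D1BFx.SliceTransferDefectHess

end
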